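import Summits.BirchSwinnertonDyer.BirchSwinnertonDyer.Theorems.AdditiveBranchIMCGordTwoRankZeroOffCaseOneThreeFieldRowClosedFifteen
import Literature.NumberTheory.EllipticCurves.HeegnerPointsOfConductorConjugationBirchProofs
import HarnessLib

/-!
# Line `three_field_road` (crux `GordTwoRankZeroOffCaseOne`, stmt-BirchSwinnertonDyer-19357) — THE SUB-ROW THEOREM FROM FOURTEEN PRINTED FACTS

Sequel of `AdditiveBranchIMCGordTwoRankZeroOffCaseOneThreeFieldRowClosedFifteen.lean` (p731112, LEAD g9). Of its fifteen named printed
hypotheses, ONE MORE IS NOW A THEOREM OF THE TREE modulo another hypothesis already on the list: Gross 1991 Prop. 5.3 under Birch's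
condition, PINNED on the Hilbert class field (`GrossLMS1991.prop53_conj_pinned_birch`, conjunct (B3) of field 2 = the genus Kolyvagin system
over the `p`-ramified field `K″`) is DISCHARGED at every level by `GrossLMS1991.prop53_conj_pinned_birch_of_exists_isNewformOf`
(`Literature/…/HeegnerPointsOfConductorConjugationBirchProofs.lean`, LEAD g9: Birch-keyed Shimura transitivity at conductor `n` on the primitive
level-transport engine, Gross's Fricke/Manin–Drinfeld computation, and the PINNING lemma across conductors) GIVEN the modularity input
`exists_isNewformOf`, which the list already carries as `nonempty_modularParametrizationData` (`exists_isNewformOf_of_nonempty_modularParametrizationData`).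
Hence:

* `missingLowerBoundAt_rankZero_of_threeFieldRow_fourteenFacts` — on the three-field sub-row of cell (G-ord, `e = 2`) in analytic rank `0`,
  `ord_p #Ш(E)_an ≤ ord_p #Ш(E)` GIVEN FOURTEEN printed theorems (Friedberg–Hoffstein F6, GZK over `ℚ`, a modular parametrisation, Gross–Zagier
  I.(7.3), Skinner–Urban 2014 Thm. 2 (a), Cai–Shu–Tian 2014 Thm. 1.1 ×2, Mazur 1978 Cor. 4.1, Hsieh 2014 Thm. B, Liu–Zhang–Zhang 2018, Hoffstein–Luo
  1997, Nekovář 2007 (4.9), Castella–Liu–Wan 2022 Thm. 8.2.1 and §6.1);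
* `gordTwoRankZeroOffCaseOne_of_fourteenFacts_of_residual` — the crux `AdditiveBranchIMC.GordTwoRankZeroOffCaseOne` BY NAME from the same fourteen
  facts and the residual statement (the registered research stub `stub_residualR0`).

THEOREMS ONLY; conditional on the named hypotheses; BSD is proved for no curve by this file; the crux item stays OPEN.
-/

noncomputable section

set_option linter.dupNamespace false

namespace Summit.BirchSwinnertonDyer.BirchSwinnertonDyer.Theorems.ThreeFieldRowClosed

open scoped Classical

open NumberField IsDedekindDomain
open WeierstrassCurve Literature.NumberTheory.EllipticCurves
  Literature.NumberTheory.EllipticCurves.ModularForms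
  Literature.NumberTheory.EllipticCurves.Rank1Residual
  Literature.NumberTheory.EllipticCurves.Rank1Residual.Typed

open Summit.BirchSwinnertonDyer.Rank1Residual
open Summit.BirchSwinnertonDyer.Rank1Residual.Additive
open Summit.BirchSwinnertonDyer.BirchSwinnertonDyer.Theorems
open Field Literature.NumberTheory.EllipticCurves.ModularForms
open ThreeFieldRoadSupply
open Summit.BirchSwinnertonDyer.BirchSwinnertonDyer.Theses.AdditiveBranchIMC

/-- **THE THREE-FIELD SUB-ROW FROM FOURTEEN PRINTED THEOREMS.** Of the fifteen named hypotheses of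
`missingLowerBoundAt_rankZero_of_threeFieldRow_fifteenFacts`, Gross 1991 Prop. 5.3 (Birch-keyed, pinned:
`GrossLMS1991.prop53_conj_pinned_birch`) is a THEOREM OF THE TREE modulo the modular parametrisation already listed
(`GrossLMS1991.prop53_conj_pinned_birch_of_exists_isNewformOf` ∘ `exists_isNewformOf_of_nonempty_modularParametrizationData`). So: for every
`E/ℚ` (globally minimal `W`) of analytic rank `0` and every prime `p` of cell (G-ord, `e = 2`) on the three-field sub-row, `ord_p #Ш(E)_an ≤ ord_p #Ш(E)`
GIVEN FOURTEEN printed theorems as named hypotheses. [cite: GrossLMS1991, §5 Prop. 5.3] [cite: JetchevSkinnerWan2017, §7.4.1 (arXiv:1512.06894 p. 30)]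
[cite: CastellaLiuWan2022, Thm. 8.2.1 (1)] -/
theorem missingLowerBoundAt_rankZero_of_threeFieldRow_fourteenFacts
    (hF6 : friedbergHoffstein_exists_twist_simpleZero_ramifiedAt_splitAt)
    (hGZK : rank_eq_analyticRank_of_analyticRank_le_one)
    (hmodP : nonempty_modularParametrizationData) (hGZ73 : GrossZagier1986_thm_I_7_3)
    (hSU : padicValRat_bsd_rank_zero) (hCST : CaiShuTian2014.thm11_trivialChar)
    (hCSTrc : CaiShuTian2014.thm11_ringClassChar) (hMaz : mazur_not_dvd_maninConstant_of_odd)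
    (hB : Hsieh2014.thmB_exists_isHsiehLFunction_coeff_norm_eq_one_unrPeriod_ramifiedSteinberg)
    (hLZZ : LiuZhangZhang2018.thm151_thm153_modularCurve_heegnerVector_additive_ramifiedSteinberg)
    (hHL : HoffsteinLuo1997_exists_twist_L_one_ne_zero)
    (hNek : Nekovar2007.cmPoint_frobeniusCongruence)
    (h821 : CastellaLiuWan2022.thm821_XGr₂_charIdeal_mul_le_awayFromCyc_pStarTwist)
    (h61 : CastellaLiuWan2022.sec61_exists_isCastellaLiuWanLFunction₂_pStarTwist)
    (W : WeierstrassCurve ℚ) [W.IsElliptic] [W.IsGloballyMinimal] (p : ℕ) [Fact p.Prime]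
    (hr : W.analyticRank = 0) (hcell : N10.CellGordTwo W p) (hrow : ThreeFieldRow W p) :
    MissingLowerBoundAt W p :=
  have hnf : exists_isNewformOf := exists_isNewformOf_of_nonempty_modularParametrizationData hmodP
  missingLowerBoundAt_rankZero_of_threeFieldRow_fifteenFacts hF6 hGZK hmodP hGZ73 hSU hCST hCSTrc hMaz hB hLZZ hHL hNek
    (fun N _ W' K _ _ ↦ GrossLMS1991.prop53_conj_pinned_birch_of_exists_isNewformOf hnf N W' K) h821 h61 W p hr hcell hrow

/-- **THE CRUX FROM FOURTEEN PRINTED THEOREMS AND THE RESIDUAL** — the registered skeleton's composition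
`ThreeFieldRoad.GordTwoRankZeroOffCaseOne_of` with both registered stubs as hypotheses, the cite stub shrunk to fourteen conjuncts: by
cases on «the curve lies on the three-field sub-row» — on it `missingLowerBoundAt_rankZero_of_threeFieldRow_fourteenFacts`, off it the
residual statement (`p = 3`; `ρ̄` not onto; a second additive prime; no Wan prime; `p ∣ ∏ c_ℓ(E)` — research, by design). Concludes
`AdditiveBranchIMC.GordTwoRankZeroOffCaseOne` BY NAME; conditional on its hypotheses; closes nothing.
[cite: GrossLMS1991, §5 Prop. 5.3] [cite: CastellaLiuWan2022, Thm. 8.2.1 (1)] -/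
theorem gordTwoRankZeroOffCaseOne_of_fourteenFacts_of_residual
    (hF6 : friedbergHoffstein_exists_twist_simpleZero_ramifiedAt_splitAt)
    (hGZK : rank_eq_analyticRank_of_analyticRank_le_one)
    (hmodP : nonempty_modularParametrizationData) (hGZ73 : GrossZagier1986_thm_I_7_3)
    (hSU : padicValRat_bsd_rank_zero) (hCST : CaiShuTian2014.thm11_trivialChar)
    (hCSTrc : CaiShuTian2014.thm11_ringClassChar) (hMaz : mazur_not_dvd_maninConstant_of_odd)
    (hB : Hsieh2014.thmB_exists_isHsiehLFunction_coeff_norm_eq_one_unrPeriod_ramifiedSteinberg)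
    (hLZZ : LiuZhangZhang2018.thm151_thm153_modularCurve_heegnerVector_additive_ramifiedSteinberg)
    (hHL : HoffsteinLuo1997_exists_twist_L_one_ne_zero)
    (hNek : Nekovar2007.cmPoint_frobeniusCongruence)
    (h821 : CastellaLiuWan2022.thm821_XGr₂_charIdeal_mul_le_awayFromCyc_pStarTwist)
    (h61 : CastellaLiuWan2022.sec61_exists_isCastellaLiuWanLFunction₂_pStarTwist)
    (hres : ∀ (W : WeierstrassCurve ℚ) [W.IsElliptic] [W.IsGloballyMinimal] (p : ℕ) [Fact p.Prime],
      W.analyticRank = 0 → N10.CellGordTwo W p → ¬ HasCaseOneMember W p → ¬ ThreeFieldRow W p →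
        MissingLowerBoundAt W p) :
    GordTwoRankZeroOffCaseOne := by
  intro W _ _ p _ hr hcell hc1
  by_cases hs : ThreeFieldRow W p
  · exact missingLowerBoundAt_rankZero_of_threeFieldRow_fourteenFacts hF6 hGZK hmodP hGZ73 hSU hCST hCSTrc hMaz hB hLZZ hHL
      hNek h821 h61 W p hr hcell hs
  · exact hres W p hr hcell hc1 hs

end Summit.BirchSwinnertonDyer.BirchSwinnertonDyer.Theorems.ThreeFieldRowClosed

end
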